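import Mathlib
import HarnessLib
import HarnessLib.Audit
import Summits.Parity.Statement
import Literature.NumberTheory.Sieve.PolynomialCongruences

/-!
Route: TwoCMLines

CLOSED (retired) 2026-08-15T13:50:49Z by operator:999:1257524 — reason: not-a-thesis: assembly does not conclude the sub-problem Statement — note: D-0027 §2.1 audit (human 2026-08-15: routes that do not decide the summit are removed): the assembly concludes `TwoCmBH`, not the sub-problem statement; a NEW conforming route may be opened from the same idea (generated `closes : … → _root_.BatemanHorn`).. The file is kept as the record of this route; refuted decls are indexed as negative knowledge (`ledger negatives`).

# Route TwoCMLines — n²+1 and n²+3 both prime as one Möbius tail of (X²+1)(X²+3) — crossed-Salié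
bilinear piece, twisted k=1 tails, joint cofactor atom

Realises card two-cm-lines-crossed-salie (spine). F = (X²+1, X²+3) is the first Bateman–Horn system
with NO linear member:
its prime values are the twin primes p, p+2 with p − 1 a square (n = 2, 4, 10, 14, 74, 94, 130, …;
odd n give two even values). With
Λ(m) = −Σ_{d|m} μ(d) log d, Λ(n²+1)Λ(n²+3) = Σ_{d₁|n²+1, d₂|n²+3} μ(d₁) log d₁ · μ(d₂) log d₂ is ONE
signed sum over the divisors
c = d₁d₂ of the reducible quartic P(n) = (n²+1)(n²+3) (μ(c) = μ(d₁)μ(d₂); the split is unique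
because (n²+1, n²+3) | 2; by
Λ₂ = μ∗log² = Λ·log + Λ∗Λ it equals ½Λ₂(P(n)) for even n — Selberg's Λ₂ reads the prime PAIR as one
almost-prime condition on P(n)).
Cut the (d₁, d₂)-plane at Y = x^{1−η}, Z = x^{1+η}: the product-cutoff part d₁d₂ ≤ Y is Type I
(support TypeIMainTerm, shared
verbatim with PolynomialMobius/CubicRoots, ~ C(F)·x), and it suffices to show that the rest of the
(d₁, d₂)-plane contributes
o(x), which we file as THREE pieces whose regions partition {d₁d₂ > Y} exactly: X = CrossedMoebius ∧
MixedTail ∧ JointCofactor.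
CrossedMoebius = {d₁, d₂ ≤ Y, d₁d₂ > Y}: both moduli below x but joint modulus up to x^{2−2η} ≫ x —
a genuinely BILINEAR form in
the two root systems ν₁² ≡ −1 (d₁), ν₂² ≡ −3 (d₂) whose Weyl sums are the crossed Salié products
S_{X²+1}(h d̄₂; d₁)·S_{X²+3}(h d̄₁; d₂)
(support CrossedCRT) — the route's new object. MixedTail = {max dᵢ > Y, min dᵢ ≤ Z}: the k = 1
window/cofactor statements of each
factor along the root progressions of the other, Möbius-averaged over the modulus. JointCofactor =
{d₁, d₂ > Z}: joint Möbius
randomness of the two large cofactors (atom Σ μ(n²+1)μ(n²+3) = o(x), support JointMoebiusAtom).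
Given X, Σ_{n≤x} Λ(n²+1)Λ(n²+3)
~ C(F)x and LambdaToCount yields TwoCmBH = BatemanHornAsymptotic F. Two engine cruxes calibrate the
new object without being in
the assembly chain: QuarticRootsPowerSaving (power-saving equidistribution of the roots of P mod c =
smooth crossed Salié sums at
fixed frequency) and MixedDivisor (Σ τ(n²+1)τ(n²+3) ~ c·x·log²x, the card's master Type-I₂ sum, open
already at leading order).
Lean: `∀ η : ℝ, 0 < η → η < 1 / 4 → (fun x : ℕ => ∑ n ∈ Finset.Icc 1 x, ∑ d₁ ∈ Nat.divisors (n ^ 2 +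
1), ∑ d₂ ∈ Nat.divisors (n ^ 2 + 3), if (x : ℝ) ^ (1 - η) < (d₁ : ℝ) * (d₂ : ℝ) then
(ArithmeticFunction.moebius d₁ : ℝ) * Real.log d₁ * ((ArithmeticFunction.moebius d₂ : ℝ) * Real.log
d₂) else 0) =o[Filter.atTop] fun x : ℕ => (x : ℝ)`

## Assembly
Bookkeeping only (verified propositionally in Sketch.lean): fix η = 1/8. TwoCmSystem gives
IsBatemanHornSystem F; TypeIMainTerm at
(k, f, η) = (2, F, 1/8) gives C > 0, HasBatemanHornConst F C and (−1)² Σ_{n≤x} Σ_{d ∈ piFinset, d₀d₁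
≤ x^{7/8}} ∏(μ log) ~ C·x; rewrite
(F 0).eval n = n²+1, (F 1).eval n = n²+3 (Int.toNat of a positive value), piFinset over Fin 2 ≃
pairs (d₁, d₂), ∏ over Fin 2 = two
factors; Λ(n²+1)Λ(n²+3) = Σ_{d₁,d₂} μ(d₁) log d₁ μ(d₂) log d₂ by Mathlib
ArithmeticFunction.sum_moebius_mul_log_eq twice; the pairs
(d₁, d₂) with dᵢ ≥ 1 split into {d₁d₂ ≤ Y} ⊔ {d₁,d₂ ≤ Y, d₁d₂ > Y} ⊔ {max > Y, min ≤ Z} ⊔ {min > Z}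
(disjointness needs only dᵢ ≥ 1),
so Σ_n Λ(n²+1)Λ(n²+3) = [TypeI] + CrossedMoebius-piece + MixedTail-piece + JointCofactor-piece = C·x
+ o(x)
(IsEquivalent.add_isLittleO); LambdaToCount at (2, F, C) concludes BatemanHornAsymptotic F =
TwoCmBH.

Rationale: WHY THIS LINE. PROBLEMS.md §3 Parity bullet 3 ('structured polynomial instances → one-variable f')
at k = 2: every BatemanHorn route in the tree is
k = 1 (QuadraticRoots/UnimodularColumns: n²+1; CubicRoots: deg 3) or generic in k (PolynomialMobius,
product cutoff, no structure);
this route asks what is NEW when two CM quadratics must be prime simultaneously, and answers: one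
bilinear object and one joint atom.
The mechanism is the card's — the Λ₂/one-tail collapse plus the Duke–Friedlander–Iwaniec/Tóth
small-root machinery, CRT giving
crossed Salié products [DukeFriedlanderIwaniec1995, Toth2000, DukeFriedlanderIwaniec2011 =
doi:10.1093/imrn/rnr112, Hooley1964 Lemma 1 =
Literature.NumberTheory.Sieve.polyRootWeylSum_mul_of_coprime] — sharpened by one observation made
while typing it: a bilinear form
Σ α(d₁)β(d₂)(A_{d₁,d₂}(x) − x ρ₁ρ₂/d₁d₂) with GENERAL bounded coefficients admits no saving (and,
with the log-weights of the tail in place, is false outright) as soon as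
one modulus exceeds 2x (β(m) can encode the sign of the f₁-divisor sum at the unique n ≤ x in a root
class of m | n²+3), so all
Type-II content sits with BOTH moduli below
x^{1−η} (exactly CrossedMoebius; consistent with the ranges of Merikoski2022 Prop. 4, where both
factors are < x), while everything
with a modulus beyond x is k = 1-type parity material (MixedTail) or the joint atom (JointCofactor).
Imported areas: GL₂ spectral
theory of sums of Kloosterman/Salié sums and Kloosterman fractions [DeshouillersIwaniec1982,
DukeFriedlanderIwaniec1997,
DelabretecheDrappeau2020 = doi:10.4171/jems/951, Merikoski2022 = arXiv:1908.08816] for the crossed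
form; CRT mixing [KowalskiSoundararajan2021] and the tree's proof of
Hooley 1964 (Literature.NumberTheory.Sieve.hooley_polyRoots_logPowerSaving_holds) for the
qualitative rung; the large sieve at quadratic roots
(Literature.NumberTheory.Sieve.largeSieve_quadraticRoots, FriedlanderIwaniecAnnals1998 Lemma 3.2).
Negatives index: empty.

RANKED CRUXES. #0 TwoCmBH (target) — Bateman–Horn for the pair F = (X²+1, X²+3): #{n ≤ x : n²+1 and
n²+3 both prime} ~ (C(F)/4)·x/log²x with C(F) = ∏_p (1−1/p)^{−2}(1 − ω(p)/p) ≈ 2.9543 (ω(2) = ω(3) =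
1, ω(p) = 2 + χ₋₄(p) + χ₋₃(p) for p ≥ 5). The k = 2, F-slice of the conjunct BatemanHorn; no
instance of BH with a non-linear member is known. (why it might fail: A sub-family of twin primes
along a quadratic sequence: open twice over (twin primes; Landau). False only if BH fails for this F
— numerics agree to 1% at x = 10⁶ (4663 pairs vs 4617.1 predicted).) [BatemanHorn1962,
HardyLittlewoodPN3, Literature.Barriers.Parity.PrimePairParity, planner numerics compute/run_2e6.txt
(π_F(x) vs C(F)·Σ1/(log f₁ log f₂) for x ≤ 10⁶)]
#2 JointCofactor (crux) — For every η ∈ (0, 1/4): Σ_{n≤x} Σ_{d₁ | n²+1, d₂ | n²+3, d₁ > x^{1+η}, d₂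
> x^{1+η}} μ(d₁) log d₁ · μ(d₂) log d₂ = o(x) (card item Q₁₂). Cofactor reading: dᵢ = fᵢ(n)/eᵢ with
eᵢ < fᵢ(n)/x^{1+η} ≲ x^{1−η}, so this is Σ_{e₁,e₂} Σ_{n ≤ x: eᵢ | fᵢ(n)} μ((n²+1)/e₁)
μ((n²+3)/e₂)·log·log = o(x): joint Möbius randomness of the two LARGE cofactors along the joint root
classes modulo e₁e₂ ≤ x^{2−2η} (fewer than one n per class on average — a correlation sum, not a
progression statement); the (e₁, e₂) = (1, 1) term is Σ μ(n²+1)μ(n²+3) log(n²+1) log(n²+3) (support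
JointMoebiusAtom is its unweighted form). Trivial bound ≍ x log⁴x, so a saving (log x)^{4+ε} is
required. [difficulty: open-problem] (why it might fail: k=2 Chowla-type claim along a quartic, wide
open even for Σμ(n²+1)=o(x); a joint sign bias of μ((n²+1)/e₁)μ((n²+3)/e₂) on some root classes
(CCG-type, known only over F_q[u]) would give Ω(x); needs a (log x)⁴ saving over the trivial
x·log⁴x, not just o(trivial).) [Teravainen2024 (arXiv:2010.07924 Conj. 1.2: polynomial Chowla open
for every nonlinear factor), Literature.Barriers.Parity.FunctionFieldMobiusBias
(ConradConradGross2008), SawinShusterman2022 (arXiv:2008.09905: the F_q[u] analogue is a theorem),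
stmt-Parity-0650 (QuadraticRoots.QrootsCofactorPointwise: the k=1 atom) and stmt-Parity-0615,
planner numerics compute/run_2e6.txt (|Σ_{n≤y} μ(n²+1)μ(n²+3)| ≤ 1.46·√y for 100 < y ≤ 2·10⁶)]
#3 CrossedMoebius (crux) — For every η ∈ (0, 1/4): Σ_{n≤x} Σ_{d₁ | n²+1, d₂ | n²+3, d₁ ≤ x^{1−η}, d₂
≤ x^{1−η}, d₁d₂ > x^{1−η}} μ(d₁) log d₁ · μ(d₂) log d₂ = o(x) (card item W₁₂ in the only range where
it is bilinear). Each progression n ≡ νᵢ (dᵢ) has ≥ x^η terms, but the joint modulus d₁d₂ reaches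
x^{2−2η} ≫ x; after Poisson in n the error is (x/d₁d₂) Σ_{0<|h|≤d₁d₂/x^{1−ε}} Σ_{d₁,d₂} α(d₁)β(d₂)
S_{X²+1}(h d̄₂; d₁) S_{X²+3}(h d̄₁; d₂) with α = β = μ·log (support CrossedCRT): a bilinear form in
two root systems with Kloosterman-fraction coupling. Lopsided parts (min dᵢ ≤ x^{η/2}, product ≤
x^{1−η/2}) are Type I; the content is x^{η/2} ≤ d₁, d₂ ≤ x^{1−η}. [deps: CrossedCRT] [difficulty:
XL] (why it might fail: Balanced corner d₁≈d₂≈x^{1−η}: x^{1−2η} frequencies and a near-square-root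
saving in (d₁,d₂) are needed; Cauchy–Schwarz halves savings (Merikoski Prop 4: Type II only for
N<x^{0.26} at MN≈x), so μ must be opened into Type-I₂ at pair level x^{2−2η}, past MixedDivisor.)
[Merikoski2022 (arXiv:1908.08816 p.5 Prop. 4 and p.11 Remarks 14–15 and p.17 'Type I₂'),
DelabretecheDrappeau2020 (doi:10.4171/jems/951 — Type I level x^{(32−7α)/50} at P = x^α as quoted in
Merikoski2022 p.5 Prop. 3), DukeFriedlanderIwaniec1995, DukeFriedlanderIwaniec1997 (bilinear forms
with Kloosterman fractions: fixed numerator),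
Literature.NumberTheory.Sieve.largeSieve_quadraticRoots (FriedlanderIwaniecAnnals1998 Lemma 3.2),
FordMaynard2024PrimeSieves (Thm 2.5: the triple γ=1/2 θ=0 ν=1/3 on the modulus side),
Literature.Barriers.Parity.LargeSieveLevelHalf]
#4 MixedDivisor (crux) — There is c > 0 with Σ_{n≤x} τ(n²+1)·τ(n²+3) ~ c·x·log²x (the card's master
Type-I₂ sum, LEADING ORDER ONLY; the refuter's caveat (i) accepted: not theorem-grade). For even n
this is τ(P(n)), P = (X²+1)(X²+3); the order x·log²x is classical (two irreducible factors), the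
constant is not: after flipping each factor at √fᵢ(n) ≈ n one needs #{n ≤ x : c₁ | n²+1, c₂ | n²+3}
for c₁, c₂ ≤ x with pair modulus c₁c₂ up to x², and the region c₁c₂ > x carries half of the
logarithmic mass — smooth-coefficient crossed Salié sums with frequencies h ≤ c₁c₂/x (fine-scale
joint equidistribution of the typed roots of P), which Σ τ(n)τ(n+1) (Ingham: pair level = length
after the flips) never needs. The power-saving form x·Q₂(log x) + O(x^{1−δ}) is the layer-2
endpoint. [deps: QuarticRootsPowerSaving] [difficulty: XL] (why it might fail: At c₁≈c₂≈x the dual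
sum has x³ terms (h,c₁,c₂) and must save a factor x with both moduli at the Pólya–Vinogradov edge;
no automorphic object for typed roots of the reducible quartic is known (Bykovskiĭ/Kuznetsov serve
one discriminant); even Στ(n²+1)² is open.) [Hooley1963 (Στ(n²+D) = c·x·log x + c′x + O(x^{8/9}) for
one quadratic), doi:10.1017/s0305004100073242 (McKee 1995: quadratics),
doi:10.1016/j.jnt.2017.05.002 (Lapkova 2017: reducible QUADRATICS = two linear factors),
doi:10.1515/crll.1999.507.107 (Daniel 1999: binary forms of degree ≤ 4 — the two-variable analogue),
Merikoski2022 p.17 (Type I₂ beyond x as the missing input for n²+1), planner numerics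
compute/run_2e6.txt (M(x)/(x log²x) = 1.978 / 1.879 / 1.821 / 1.784 at x = 10³ / 10⁴ / 10⁵ / 10⁶)]
#5 QuarticRootsPowerSaving (crux) — For every h ≠ 0 there is δ > 0 with Σ_{c ≤ X} S_P(h; c) =
O(X^{1−δ}), where S_P(h; c) = Σ_{ν mod c, P(ν) ≡ 0} e(hν/c) = polyRootWeylSum P c h and P =
(X²+1)(X²+3) (Σ_{c≤X} ρ_P(c) ≍ X log X). For squarefree odd c the roots of P are the CRT-glued pairs
(root of X²+1 mod c₁, root of X²+3 mod c₂), c = c₁c₂, and S_P(h; c) = Σ_{c₁c₂ = c} S_{X²+1}(h c̄₂;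
c₁)·S_{X²+3}(h c̄₁; c₂): the smooth-coefficient crossed Salié sum at a fixed frequency — first rung
of the engine. A power saving is in print only for ONE irreducible quadratic (Hooley
1963/Bykovskiĭ/Tóth via Weil–Kloosterman); for reducible polynomials only linear-factor cases
(DartygeMartin2019 Thms 1–4). For fixed c₂, S_{X²+1}(h c̄₂; c₁) = S_{c₂²X²+1}(h; c₁), so lopsided
ranges are Hooley/Bykovskiĭ for the quadratics c₂²X²+1, c₁²X²+3 over moduli in progressions,
uniformly in the level; no secondary main term is expected (the residue of the root mod c₂ washes
out the twist e(hν₂c̄₁/c₂)). [deps: CrossedCRT, QuarticRootsEquidistribution] [difficulty: L] (why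
it might fail: Balanced range c₁≈c₂≈√X: after Cauchy–Schwarz the off-diagonal is a length-√X sum of
root Weyl sums twisted by Kloosterman fractions of modulus ≈X with root-entangled numerators (DFI97
needs a fixed numerator); and a secondary term ≍X (as for n(n²+1), DM Thm 2) would falsify the
O-form.) [Hooley1964 and Literature.NumberTheory.Sieve.hooley_polyRoots_logPowerSaving_holds
(irreducible f only), KowalskiSoundararajan2021 (arXiv:2003.12965 p.6 Thm 2.1 'f does not have to be
irreducible' and p.8 Remark 2.5(1)–(2)), DartygeMartin2019 (arXiv:1802.09090 pp.3–4 Thms 1–4 and p.3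
'f₁ linear and f₂ quadratic … not straightforward'), MartinSitar2010 (§3.2),
DukeFriedlanderIwaniec1997, DukeFriedlanderIwaniec2011 (doi:10.1093/imrn/rnr112), Toth2000, planner
numerics compute/run_2e6.txt (|Σ_{c≤X} polyRootWeylSum P c h| ≤ 2.1√X for h = 1 or 2 or 5 and X ≤
8000: for h=1 the values −33 / −30 / −29 / 8 / −94 at X = 250 / 10³ / 2·10³ / 4·10³ / 8·10³)]
#6 MixedTail (crux) — For every η ∈ (0, 1/4): Σ_{n≤x} Σ_{d₁ | n²+1, d₂ | n²+3, max(d₁,d₂) > x^{1−η},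
min(d₁,d₂) ≤ x^{1+η}} μ(d₁) log d₁ · μ(d₂) log d₂ = o(x). Writing −Λ(fᵢ(n)) = Lᵢ + Wᵢ + Kᵢ (level d
≤ Y, window Y < d ≤ Z, cofactor d > Z parts), this is Σ_n [L₁(W₂+K₂) + (W₁+K₁)L₂ + W₁W₂ + W₁K₂ +
K₁W₂]: the k = 1 window (W) and cofactor (Q) statements of QuadraticRoots/UnimodularColumns for EACH
factor, now along the root progressions n ≡ ν_j (d_j), d_j ≤ x^{1−η}, of the OTHER factor with
weights μ(d_j) log d_j (cancellation across moduli is allowed and probably necessary), plus the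
balanced joint window W₁W₂ (d₁ ≈ d₂ ≈ x, the k = 2 sibling of UnimodularMobius). Card items Q′₁, Q′₂
and the beyond-x part of W₁₂. [difficulty: open-problem] (why it might fail: Contains HL-E-depth
parity statements for each factor (Λ-tail of n²+3 along Möbius-weighted root progressions of n²+1,
and symmetrically); general coefficients provably fail once a modulus exceeds 2x, so only the
arithmetic of μ on the large divisor can give the log⁴ saving; no Type-II range there.)
[stmt-Parity-0648 (QuadraticRoots.QrootsWindowW) and stmt-Parity-0649 (cofactor average),
stmt-Parity-0882 (UnimodularColumns.UnimodularMobius), arXiv:2505.00493 (Grimmelt–Merikoski Thm 1.5: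
Type II for the roots only for N < X^{1/3}), FordMaynard2024PrimeSieves (Thm 2.5),
Literature.Barriers.Parity.PrimePairParity, IwaniecInventiones1978 (n²+1 = P₂: the strongest
unconditional k=1 statement)]
#9 TypeIMainTerm (support) — Shared verbatim with PolynomialMobius/CubicRoots (stmt-Parity-0873):
for every BH system f and η ∈ (0,1) there is C > 0 with HasBatemanHornConst f C and (−1)^k Σ_{n≤x}
Σ_{dᵢ | fᵢ(n), d₁⋯d_k ≤ x^{1−η}} ∏ μ(dᵢ) log dᵢ ~ C·x (elementary count in periods lcm ≤ x^{1−η} +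
log-weighted singular series via the prime ideal theorem). Used here at k = 2, f = F. [difficulty:
L] [stmt-Parity-0873, BatemanHorn1962 (§2), BombieriAsymptoticSieve1976,
Literature.NumberTheory.Sieve.exists_hasBatemanHornConst]
#9 LambdaToCount (support) — Shared verbatim (stmt-Parity-0874): Σ_{n≤x} ∏ᵢ Λ(fᵢ(n)) ~ C·x with
HasBatemanHornConst f C implies BatemanHornAsymptotic f (partial summation; prime-power values
negligible — trivial for degree 2). [difficulty: M] [stmt-Parity-0874, BatemanHorn1962]
#9 TwoCmSystem (support) — F = (X²+1, X²+3) is a Bateman–Horn system: both irreducible in ℤ[X] with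
leading coefficient 1, not associated, no fixed prime divisor (ω(2) = 1: only odd n; ω(3) = 1: only
n ≡ 0; ω(p) ≤ 4 < p for p ≥ 5). Provable now (Gauss-lemma irreducibility of monic quadratics without
integer roots; `decide`-style residue counts at 2, 3). [difficulty: provable-now] [BatemanHorn1962
(§1), Literature.NumberTheory.Sieve.polyRootCountMod_le,
Literature.NumberTheory.Sieve.polyRootCountMod_X_sq_add_one_two]
#9 CrossedCRT (support) — Crossed twisted multiplicativity (the route's dictionary lemma): for
coprime c₁, c₂ with c₁e₁ ≡ 1 (c₂), c₂e₂ ≡ 1 (c₁) and any f, g ∈ ℤ[X], Σ_{ν mod c₁c₂: c₁ | f(ν), c₂ |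
g(ν)} e(hν/(c₁c₂)) = S_f(h e₂; c₁)·S_g(h e₁; c₂). Same proof as Hooley's Lemma 1 for one polynomial
(tree: polyRootWeylSum_mul_of_coprime, stdAddChar_mul_eq_mul_of_coprime), with f on one side and g
on the other; degenerate c₁c₂ = 0 holds trivially. Provable now (~40 lines). [difficulty:
provable-now] [Hooley1964 (Lemma 1), Literature.NumberTheory.Sieve.polyRootWeylSum_mul_of_coprime,
MartinSitar2010 (§3.2: 'Lemmas 1–3 depend only on the CRT')]
#9 QuarticRootsEquidistribution (support) — Qualitative rung under crux 5: for h ≠ 0, Σ_{c≤X} S_P(h;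
c) = o(X log X), P = (X²+1)(X²+3) (the roots ν/c of P, ≍ X log X of them up to X, are
equidistributed mod 1 in Hooley's measure). Hooley's 1964 argument uses irreducibility only through
the root-density input; for P the mean of √ρ_P(p) over primes is ¼·2 + ½·√2 = 1.207 < 2 = mean
ρ_P(p), so the tree's proof of hooley_polyRoots_logPowerSaving adapts (saving (log X)^{0.79−o(1)} on
Σ|S_P|); Kowalski–Soundararajan state the reducible case (Thm 2.1; Remark 2.5(1) for Hooley's
measure). Provable with effort. [difficulty: L] [KowalskiSoundararajan2021 (arXiv:2003.12965 p.6 Thm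
2.1 and p.8 Remark 2.5(1)), Hooley1964,
Literature.NumberTheory.Sieve.hooley_polyRoots_logPowerSaving_holds, DartygeMartin2019 (Lemma 5),
MartinSitar2010]
#9 JointMoebiusAtom (support) — The unweighted joint atom (special case (e₁,e₂) = (1,1) of crux 2,
numerically testable): Σ_{n≤x} μ(n²+1)μ(n²+3) = o(x) (μ(n²+3) = 0 for odd n since 4 | n²+3, so only
even n count). Open (k = 2 polynomial Chowla, μ-form); planner numerics: 6, 63, −391, −10, 405 at x
= 10³, 10⁴, 10⁵, 3·10⁵, 10⁶, |J(y)| ≤ 1.46√y to 2·10⁶. [difficulty: open-problem] [Teravainen2024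
(arXiv:2010.07924 Conj. 1.2), stmt-Parity-0615, stmt-Parity-0650, planner numerics
compute/run_2e6.txt (J(x) for x ≤ 2·10⁶)]

TWO-LAYER PLAN. Foreseen glued splits (nothing filed now; k ≤ 3, depth 1):
- QuarticRootsPowerSaving ⇐ LopsidedUniform (Σ_{c₁ ≡ b (c₂), c₁ ≤ X/c₂} S_{c₂²X²+1}(h; c₁) ≪
(X/c₂)^{1−δ} uniformly for c₂ ≤ X^θ, and symmetrically) → BalancedCrossed (c₁, c₂ ∈ [X^θ, X^{1−θ}]:
any power saving in the crossed bilinear Salié sum) → QuarticRootsPowerSaving.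
- MixedDivisor ⇐ PairLevelBeyondX (Σ_{c₁∼M, c₂∼N} (A_{c₁,c₂}(x) − xρ₁ρ₂/c₁c₂) ≪ x^{1−δ} for MN ≤
x^{1+θ}: the pair analogue of Hooley 1967/DI 1982) → FineScaleJoint (o(1)-saving up to MN ≤ x²,
smooth weights) → MixedDivisor.
- CrossedMoebius ⇐ CrossedTypeI2 (one variable opened by Heath-Brown into a long smooth factor: sums
of Salié sums over the modulus, Kuznetsov/DI) → CrossedTypeII (general α, β, x^{η/2} ≤ M, N ≤
x^{1−η}, MN ≤ x^{1+θ}) → CrossedMoebius.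
- MixedTail ⇐ TwistedTails (min dᵢ ≤ Y: k = 1 tails along root progressions) → JointWindow (Y < min
dᵢ ≤ Z) → MixedTail.
- JointCofactor: no split foreseen before the JointMoebiusAtom numerics; possible later by (e₁,
e₂)-ranges.

KILL CRITERIA. JointCofactor refuted (an Ω(x) joint Möbius bias of the large cofactors) ⇒ given
CrossedMoebius, MixedTail and the glue this is
¬TwoCmBH ⇒ ¬BatemanHorn: close `refuted:JointCofactor`, file the ¬-statements, flag the conjunct;
JointMoebiusAtom refuted (a drift in
Σμ(n²+1)μ(n²+3)) does not formally negate TwoCmBH but makes JointCofactor untenable (same bias with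
log-weights) ⇒ close likewise. QuarticRootsPowerSaving refuted by
a secondary term C_h·X ⇒ restate with the term (pivot, engine survives); refuted by Ω(X^{1−o(1)}) ⇒
the crossed-Salié engine is dead —
close (the decomposition survives as the k = 2 slice of PolynomialMobius). CrossedMoebius refuted
for some η but not all ⇒ re-cut
(pivot); for all small η ⇒ close. MixedDivisor refuted (M(x)/(x log²x) provably oscillates) ⇒ the
joint singular-series heuristic
fails for divisors already: close and record as a barrier candidate. TypeIMainTerm refuted ⇒ shared
normalisation error
(PolynomialMobius/CubicRoots tenure re-derives; this route follows). PolyMobiusTail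
(stmt-Parity-0870) proved ⇒ close `superseded`.

NOT DECOMPOSED YET. The Heath-Brown/Vaughan opening of μ(d₁), μ(d₂) inside CrossedMoebius; the
h-aspect (pair level beyond X) of the quartic's root sums;
uniformity of Bykovskiĭ-type bounds in the level (c₂²-dependence, exceptional-eigenvalue θ = 7/64
losses); the p = 2, 3 and
non-squarefree bookkeeping behind CrossedCRT-expansions of S_P; the even/odd-n split (odd n: both
values even, μ(n²+3) = 0); the
general-coefficient failure lemma (one modulus > 2x) as a formal negative statement; other
discriminant pairs and k ≥ 3 (k-fold
crossed products); any use of the genus-one curve y² = x²+1, z² = x²+3.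

CHEAPEST FALSIFIER. (1) JointMoebiusAtom numerics J(x) = Σ_{n≤x} μ(n²+1)μ(n²+3) to 10⁹ (card
k2-cubic-parity-objects-measured (O2); kit was unavailable
to me — compute socket absent): I ran x ≤ 2·10⁶ locally (compute/twocm_small.py, pure Python): J =
6, 63, −391, −10, 405 at x =
10³, 10⁴, 10⁵, 3·10⁵, 10⁶ and max_{100<y≤2·10⁶} |J(y)|/√y = 1.45 — square-root behaviour, no drift;
a drift |J(x)| > 10⁻³x at 10⁸–10⁹
refutes the atom. (2) Σ_{c≤X} S_P(h; c)/X for X to 10⁷, h = 1…5: a nonzero limit refutes the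
O(X^{1−δ}) form of crux 5 (I found
|Σ| ≤ 2.1√X for X ≤ 8000). (3) Lookup: a quantitative treatment of root Weyl sums for a product of
two irreducible quadratics
(Dartyge–Martin sequels; papers citing Kowalski–Soundararajan 2021) would make crux 5 `known` — none
found (searches below).

NUMBERS. C(F) = 2.954307 (Euler product to 2·10⁶ accelerated by L(1,χ₋₄)L(1,χ₋₃) = π²/(12√3)).
π_F(x) = 28, 120, 689, 4663 at x = 10³, 10⁴,
10⁵, 10⁶ vs C(F)·Σ_{n≤x} 1/(log(n²+1) log(n²+3)) = 28.9, 123.1, 701.8, 4617.1 (ratios 0.97–1.01).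
M(x)/(x log²x) = 1.978, 1.879,
1.821, 1.784 at x = 10³…10⁶ (decreasing; order x log²x). Σμ(n²+1), Σμ(n²+3) to 10⁶: −380, −593. Root
count Σ_{c≤X}ρ_P(c)/(X log X)
= 0.37 at X = 8000. One-quadratic benchmarks at P = x^α (n²+1): Type I level x^{1−ε}P^{−1/2}
(DeshouillersIwaniec1982),
x^{(32−7α)/50−η} (DelabretecheDrappeau2020, θ = 7/64); Type II x^{α−1+η} ≪ N ≪ x^{(57−32α)/96−η},
non-trivial iff α < 153/128;
P⁺(n²+1) > x^{1.279} i.o. (Merikoski2022). Hooley exponent data for P: ρ_P(p) ∈ {0,2,4} with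
densities ¼, ½, ¼ (p mod 12).
Items at open: 13 (target 1, cruxes 5, support 6, assembly 1).

DEFINITION REQUESTS. None. polyRootWeylSum, polyRootCountMod, IsBatemanHornSystem,
BatemanHornAsymptotic, HasBatemanHornConst exist in
Literature.NumberTheory.Sieve (import Literature.NumberTheory.Sieve.PolynomialCongruences added);
the joint (typed) root Weyl sum
is spelled out inside CrossedCRT rather than requested as a notion (single use). If crux 5 gets
staffed, a notion
`jointRootWeylSum f g c₁ c₂ h` in Literature/NumberTheory/Sieve would be worth a definition item
then.

Novelty: Searches (2026-08-15): `lit frontier Parity --since 2020` (30 rows: none on k ≥ 2 BH or reducible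
root sums; arXiv:2605.01155
random BH sets = model support); `lit bridges Parity --cross any` (30: none); `lit search --source
crossref` ×4 ("Weyl sums for
quadratic roots" → doi:10.1093/imrn/rnr112; "average number of divisors of reducible quadratic
polynomials" → Lapkova 2017, McKee
1995, Dudek–Pańkowski–Scharaschkin 2018, all with LINEAR factors; "divisor problem for binary forms
of degree 4" → Daniel 1999,
Browning 2011, Greaves 1970, two-variable forms; "Niveau de répartition des polynômes quadratiques"
→ doi:10.4171/jems/951);
`lit search --source zbmath` ×4 (prime pairs of quadratic polynomials: only F_q[T] twin-prime
analogues, Effinger 2008); `lit galaxy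
search … --star all` ×5 ("roots of quadratic congruences", "Kloosterman fractions", "reducible
quartic polynomial", "n^2+1 and
n^2+3", "divisor problem reducible polynomial two quadratic factors": nothing on two quadratic
factors); `lit read` arXiv:2003.12965
pp.6–8, arXiv:1802.09090 pp.3–4, arXiv:1908.08816 pp.3, 5, 11, 17; `lean search` (polyRootWeylSum
API, CRT lemma, FI large sieve,
Hooley proof); the 125 BatemanHorn idea cards (k = 2 appears only in ms-variance-nsq1-subpoisson,
linear-member-asymptotic-sieve,
k2-cubic-parity-objects-measured, gaussian-kloosterman-fractions-window is k = 1); local searchd rc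
75 twice, OpenAlex/S2/arXiv 429.
Nearest prior art found: (i) Λ_k/asymptotic-sieve folklore (Selberg Λ₂; Bombi  [refs: 10.1093/imrn/rnr112, 10.4171/jems/951, 2605.01155, 2003.12965, 1802.09090, 1908.08816, 2505.00493, doi:10.1093/imrn/rnr112, doi:10.4171/jems/951, BombieriAsymptoticSieve1976, DukeFriedlanderIwaniec1995, Toth2000, Merikoski2022, DartygeMartin2019, MartinSitar2010, KowalskiSoundararajan2021]

Barriers (technique_class: crossed-salie-bilinear kuznetsov type-I2 quadratic-pairs): - technique_class: crossed-salie-bilinear kuznetsov type-I2 quadratic-pairs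
- Literature.Barriers.Parity.SelbergParityBarrier: applies to the frame — Type-I data of level
x^{1−η} fix only TypeIMainTerm
(Literature.NumberTheory.Sieve.bombieri_asymptotic_sieve_indeterminacy); not evaded: parity is NAMED
and isolated in JointCofactor and MixedTail, while CrossedMoebius, QuarticRootsPowerSaving and
MixedDivisor are equidistribution statements with both moduli below x (Type-II-shaped on the modulus
side), which Selberg's examples do not obstruct.
- Literature.Barriers.Parity.PrimePairParity: applies verbatim — (n²+1, n²+3) IS a prime pair and no
sieve-theoretic deduction from discrepancy bounds is attempted; the bet is the evasion the source
itself names (bilinear sums with Λ/μ on the far variable), here in the concrete form MixedTail (μ(d)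
log d against Λ-tails of the other factor along root progressions) plus the joint atom.
- Literature.Barriers.Parity.FordMaynardLowLevel: applies on the VALUE side (P(n) ≤ x⁴ takes x
values, c = 1/4 < 1/2: no Type-I/II scheme detects primes; each factor alone c = 1/2); the route's
Type-I/II information lives on the MODULUS side (positive-density root sequences, where
FordMaynard2024 Thm 2.5's (1/2, 0, 1/3) holds); it does not evade the barrier for JointCofactor —
honest parity bet.
- Literature.Barriers.Parity.FordMaynardMinimalTypeII: CrossedMoebius is Type II in the moduli with
both variables in [x^{η/2}, x^{1−η}]; for MixedTail no Type-II ra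

Novelty grade: new-combination — route-review grade (refuter rreview-63142eff-0; route retired 13:50Z §2.1, grade recorded for the re-open; full review = route evidence REVIEW-TwoCMLines.md): new-combination = PolynomialMobius Λ⊗Λ product-cutoff tail split × Hooley/DFI/Tóth root-congruence machinery crossed over two discriminants b (refuter refuter-rreview-route-Parity-TwoCMLines--63142eff-0, 2026-08-15T13:58:18Z; prior: route-Parity-PolynomialMobius (stmt-Parity-0870/0873/0874), Hooley1964, DukeFriedlanderIwaniec1995, Toth2000, arXiv:1908.08816, arXiv:1802.09090, arXiv:2003.12965, doi:10.4171/jems/951)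

History (route lifecycle, newest last):
- 2026-08-15T13:50:49Z · CLOSED retired — not-a-thesis: assembly does not conclude the sub-problem Statement (operator:999:1257524)

sub-problem: BatemanHorn · status: closed(retired) · opened planner-plancard-Parity-BatemanHorn-two-cm-li-c073299a-0 2026-08-15T12:27:27Z · rev 0 · ledger route-Parity-TwoCMLines
GENERATED by the gate from the ledger (D-0016/17). Provers cite these decls: `theorem foo : Summit.Parity.BatemanHorn.Theses.TwoCMLines.<Decl> := …` in Summits/Parity/BatemanHorn/Theorems/<Name>.lean.
-/

namespace Summit.Parity.BatemanHorn.Theses.TwoCMLines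

open scoped BigOperators Topology Manifold Classical MeasureTheory ProbabilityTheory Matrix InnerProductSpace ComplexConjugate ContinuousMap
open Filter Set Function TopologicalSpace MeasureTheory

attribute [summit_statement] _root_.BatemanHorn

/-- item stmt-Parity-8073 · target · rank 0 · closed · moot by None · by planner
why it might fail: A sub-family of twin primes along a quadratic sequence: open twice over (twin primes; Landau). False only if BH fails for this F — numerics agree to 1% at x = 10⁶ (4663 pairs vs 4617.1 predicted).
sources: BatemanHorn1962, HardyLittlewoodPN3, Literature.Barriers.Parity.PrimePairParity, planner numerics compute/run_2e6.txt (π_F(x) vs C(F)·Σ1/(log f₁ log f₂) for x ≤ 10⁶)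
[target] Bateman–Horn for the pair F = (X²+1, X²+3): #{n ≤ x : n²+1 and n²+3 both prime} ~
(C(F)/4)·x/log²x with C(F) = ∏_p (1−1/p)^{−2}(1 − ω(p)/p) ≈ 2.9543 (ω(2) = ω(3) = 1, ω(p) = 2 +
χ₋₄(p) + χ₋₃(p) for p ≥ 5). The k = 2, F-slice of the conjunct BatemanHorn; no instance of BH with a
non-linear member is known. -/
@[route_item "route-Parity-TwoCMLines"]
def TwoCmBH : Prop :=
  Literature.NumberTheory.Sieve.BatemanHornAsymptotic ![(Polynomial.X ^ 2 + 1 : Polynomial ℤ), Polynomial.X ^ 2 + 3]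

/-- item stmt-Parity-8074 · crux · rank 2 · closed · moot by None · by planner
why it might fail: k=2 Chowla-type claim along a quartic, wide open even for Σμ(n²+1)=o(x); a joint sign bias of μ((n²+1)/e₁)μ((n²+3)/e₂) on some root classes (CCG-type, known only over F_q[u]) would give Ω(x); needs a (log x)⁴ saving over the trivial x·log⁴x, not just o(trivial).
sources: Teravainen2024 (arXiv:2010.07924 Conj. 1.2: polynomial Chowla open for every nonlinear factor), Literature.Barriers.Parity.FunctionFieldMobiusBias (ConradConradGross2008), SawinShusterman2022 (arXiv:2008.09905: the F_q[u] analogue is a theorem), stmt-Parity-0650 (QuadraticRoots.QrootsCofactorPointwise: the k=1 atom) and stmt-Parity-0615, planner numerics compute/run_2e6.txt (|Σ_{n≤y} μ(n²+1)μ(n²+3)| ≤ 1.46·√y for 100 < y ≤ 2·10⁶)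
[crux] For every η ∈ (0, 1/4): Σ_{n≤x} Σ_{d₁ | n²+1, d₂ | n²+3, d₁ > x^{1+η}, d₂ > x^{1+η}} μ(d₁)
log d₁ · μ(d₂) log d₂ = o(x) (card item Q₁₂). Cofactor reading: dᵢ = fᵢ(n)/eᵢ with eᵢ <
fᵢ(n)/x^{1+η} ≲ x^{1−η}, so this is Σ_{e₁,e₂} Σ_{n ≤ x: eᵢ | fᵢ(n)} μ((n²+1)/e₁)
μ((n²+3)/e₂)·log·log = o(x): joint Möbius randomness of the two LARGE cofactors along the joint root
classes modulo e₁e₂ ≤ x^{2−2η} (fewer than one n per class on average — a correlation sum, not a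
progression statement); the (e₁, e₂) = (1, 1) term is Σ μ(n²+1)μ(n²+3) log(n²+1) log(n²+3) (support
JointMoebiusAtom is its unweighted form). Trivial bound ≍ x log⁴x, so a saving (log x)^{4+ε} is
required. [difficulty: open-problem] -/
@[route_item "route-Parity-TwoCMLines"]
def JointCofactor : Prop :=
  ∀ η : ℝ, 0 < η → η < 1 / 4 → (fun x : ℕ => ∑ n ∈ Finset.Icc 1 x, ∑ d₁ ∈ Nat.divisors (n ^ 2 + 1), ∑ d₂ ∈ Nat.divisors (n ^ 2 + 3), if (x : ℝ) ^ (1 + η) < (d₁ : ℝ) ∧ (x : ℝ) ^ (1 + η) < (d₂ : ℝ) then (ArithmeticFunction.moebius d₁ : ℝ) * Real.log d₁ * ((ArithmeticFunction.moebius d₂ : ℝ) * Real.log d₂) else 0) =o[Filter.atTop] fun x : ℕ => (x : ℝ)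

/-- item stmt-Parity-8075 · crux · rank 3 · closed · moot by None · by planner
why it might fail: Balanced corner d₁≈d₂≈x^{1−η}: x^{1−2η} frequencies and a near-square-root saving in (d₁,d₂) are needed; Cauchy–Schwarz halves savings (Merikoski Prop 4: Type II only for N<x^{0.26} at MN≈x), so μ must be opened into Type-I₂ at pair level x^{2−2η}, past MixedDivisor.
sources: Merikoski2022 (arXiv:1908.08816 p.5 Prop. 4 and p.11 Remarks 14–15 and p.17 'Type I₂'), DelabretecheDrappeau2020 (doi:10.4171/jems/951 — Type I level x^{(32−7α)/50} at P = x^α as quoted in Merikoski2022 p.5 Prop. 3), DukeFriedlanderIwaniec1995, DukeFriedlanderIwaniec1997 (bilinear forms with Kloosterman fractions: fixed numerator), Literature.NumberTheory.Sieve.largeSieve_quadraticRoots (FriedlanderIwaniecAnnals1998 Lemma 3.2), FordMaynard2024PrimeSieves (Thm 2.5: the triple γ=1/2 θ=0 ν=1/3 on the modulus side)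
[crux] For every η ∈ (0, 1/4): Σ_{n≤x} Σ_{d₁ | n²+1, d₂ | n²+3, d₁ ≤ x^{1−η}, d₂ ≤ x^{1−η}, d₁d₂ >
x^{1−η}} μ(d₁) log d₁ · μ(d₂) log d₂ = o(x) (card item W₁₂ in the only range where it is bilinear).
Each progression n ≡ νᵢ (dᵢ) has ≥ x^η terms, but the joint modulus d₁d₂ reaches x^{2−2η} ≫ x; after
Poisson in n the error is (x/d₁d₂) Σ_{0<|h|≤d₁d₂/x^{1−ε}} Σ_{d₁,d₂} α(d₁)β(d₂) S_{X²+1}(h d̄₂; d₁)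
S_{X²+3}(h d̄₁; d₂) with α = β = μ·log (support CrossedCRT): a bilinear form in two root systems
with Kloosterman-fraction coupling. Lopsided parts (min dᵢ ≤ x^{η/2}, product ≤ x^{1−η/2}) are Type
I; the content is x^{η/2} ≤ d₁, d₂ ≤ x^{1−η}. [deps: CrossedCRT] [difficulty: XL] -/
@[route_item "route-Parity-TwoCMLines"]
def CrossedMoebius : Prop :=
  ∀ η : ℝ, 0 < η → η < 1 / 4 → (fun x : ℕ => ∑ n ∈ Finset.Icc 1 x, ∑ d₁ ∈ Nat.divisors (n ^ 2 + 1), ∑ d₂ ∈ Nat.divisors (n ^ 2 + 3), if (d₁ : ℝ) ≤ (x : ℝ) ^ (1 - η) ∧ (d₂ : ℝ) ≤ (x : ℝ) ^ (1 - η) ∧ (x : ℝ) ^ (1 - η) < (d₁ : ℝ) * (d₂ : ℝ) then (ArithmeticFunction.moebius d₁ : ℝ) * Real.log d₁ * ((ArithmeticFunction.moebius d₂ : ℝ) * Real.log d₂) else 0) =o[Filter.atTop] fun x : ℕ => (x : ℝ)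

/-- item stmt-Parity-8076 · crux · rank 4 · closed · moot by None · by planner
why it might fail: At c₁≈c₂≈x the dual sum has x³ terms (h,c₁,c₂) and must save a factor x with both moduli at the Pólya–Vinogradov edge; no automorphic object for typed roots of the reducible quartic is known (Bykovskiĭ/Kuznetsov serve one discriminant); even Στ(n²+1)² is open.
sources: Hooley1963 (Στ(n²+D) = c·x·log x + c′x + O(x^{8/9}) for one quadratic), doi:10.1017/s0305004100073242 (McKee 1995: quadratics), doi:10.1016/j.jnt.2017.05.002 (Lapkova 2017: reducible QUADRATICS = two linear factors), doi:10.1515/crll.1999.507.107 (Daniel 1999: binary forms of degree ≤ 4 — the two-variable analogue), Merikoski2022 p.17 (Type I₂ beyond x as the missing input for n²+1), planner numerics compute/run_2e6.txt (M(x)/(x log²x) = 1.978 / 1.879 / 1.821 / 1.784 at x = 10³ / 10⁴ / 10⁵ / 10⁶)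
[crux] There is c > 0 with Σ_{n≤x} τ(n²+1)·τ(n²+3) ~ c·x·log²x (the card's master Type-I₂ sum,
LEADING ORDER ONLY; the refuter's caveat (i) accepted: not theorem-grade). For even n this is
τ(P(n)), P = (X²+1)(X²+3); the order x·log²x is classical (two irreducible factors), the constant is
not: after flipping each factor at √fᵢ(n) ≈ n one needs #{n ≤ x : c₁ | n²+1, c₂ | n²+3} for c₁, c₂ ≤
x with pair modulus c₁c₂ up to x², and the region c₁c₂ > x carries half of the logarithmic mass —
smooth-coefficient crossed Salié sums with frequencies h ≤ c₁c₂/x (fine-scale joint equidistribution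
of the typed roots of P), which Σ τ(n)τ(n+1) (Ingham: pair level = length after the flips) never
needs. The power-saving form x·Q₂(log x) + O(x^{1−δ}) is the layer-2 endpoint. [deps:
QuarticRootsPowerSaving] [difficulty: XL] -/
@[route_item "route-Parity-TwoCMLines"]
def MixedDivisor : Prop :=
  ∃ c : ℝ, 0 < c ∧ Asymptotics.IsEquivalent Filter.atTop (fun x : ℕ => ∑ n ∈ Finset.Icc 1 x, ((Nat.divisors (n ^ 2 + 1)).card : ℝ) * ((Nat.divisors (n ^ 2 + 3)).card : ℝ)) (fun x : ℕ => c * (x : ℝ) * Real.log x ^ 2)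

/-- item stmt-Parity-8077 · crux · rank 5 · closed · moot by None · by planner
why it might fail: Balanced range c₁≈c₂≈√X: after Cauchy–Schwarz the off-diagonal is a length-√X sum of root Weyl sums twisted by Kloosterman fractions of modulus ≈X with root-entangled numerators (DFI97 needs a fixed numerator); and a secondary term ≍X (as for n(n²+1), DM Thm 2) would falsify the O-form.
sources: Hooley1964 and Literature.NumberTheory.Sieve.hooley_polyRoots_logPowerSaving_holds (irreducible f only), KowalskiSoundararajan2021 (arXiv:2003.12965 p.6 Thm 2.1 'f does not have to be irreducible' and p.8 Remark 2.5(1)–(2)), DartygeMartin2019 (arXiv:1802.09090 pp.3–4 Thms 1–4 and p.3 'f₁ linear and f₂ quadratic … not straightforward'), MartinSitar2010 (§3.2), DukeFriedlanderIwaniec1997, DukeFriedlanderIwaniec2011 (doi:10.1093/imrn/rnr112)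
[crux] For every h ≠ 0 there is δ > 0 with Σ_{c ≤ X} S_P(h; c) = O(X^{1−δ}), where S_P(h; c) = Σ_{ν
mod c, P(ν) ≡ 0} e(hν/c) = polyRootWeylSum P c h and P = (X²+1)(X²+3) (Σ_{c≤X} ρ_P(c) ≍ X log X).
For squarefree odd c the roots of P are the CRT-glued pairs (root of X²+1 mod c₁, root of X²+3 mod
c₂), c = c₁c₂, and S_P(h; c) = Σ_{c₁c₂ = c} S_{X²+1}(h c̄₂; c₁)·S_{X²+3}(h c̄₁; c₂): the
smooth-coefficient crossed Salié sum at a fixed frequency — first rung of the engine. A power saving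
is in print only for ONE irreducible quadratic (Hooley 1963/Bykovskiĭ/Tóth via Weil–Kloosterman);
for reducible polynomials only linear-factor cases (DartygeMartin2019 Thms 1–4). For fixed c₂,
S_{X²+1}(h c̄₂; c₁) = S_{c₂²X²+1}(h; c₁), so lopsided ranges are Hooley/Bykovskiĭ for the quadratics
c₂²X²+1, c₁²X²+3 over moduli in progressions, uniformly in the level; no secondary main term is
expected (the residue of the root mod c₂ washes out the twist e(hν₂c̄₁/c₂)). [deps: CrossedCRT,
QuarticRootsEquidistribution] [difficulty: L] -/
@[route_item "route-Parity-TwoCMLines"]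
def QuarticRootsPowerSaving : Prop :=
  ∀ h : ℤ, h ≠ 0 → ∃ δ : ℝ, 0 < δ ∧ (fun N : ℕ => ∑ c ∈ Finset.Icc 1 N, Literature.NumberTheory.Sieve.polyRootWeylSum ((Polynomial.X ^ 2 + 1) * (Polynomial.X ^ 2 + 3)) c h) =O[Filter.atTop] fun N : ℕ => (N : ℝ) ^ (1 - δ)

/-- item stmt-Parity-8078 · crux · rank 6 · closed · moot by None · by planner
why it might fail: Contains HL-E-depth parity statements for each factor (Λ-tail of n²+3 along Möbius-weighted root progressions of n²+1, and symmetrically); general coefficients provably fail once a modulus exceeds 2x, so only the arithmetic of μ on the large divisor can give the log⁴ saving; no Type-II range there.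
sources: stmt-Parity-0648 (QuadraticRoots.QrootsWindowW) and stmt-Parity-0649 (cofactor average), stmt-Parity-0882 (UnimodularColumns.UnimodularMobius), arXiv:2505.00493 (Grimmelt–Merikoski Thm 1.5: Type II for the roots only for N < X^{1/3}), FordMaynard2024PrimeSieves (Thm 2.5), Literature.Barriers.Parity.PrimePairParity, IwaniecInventiones1978 (n²+1 = P₂: the strongest unconditional k=1 statement)
[crux] For every η ∈ (0, 1/4): Σ_{n≤x} Σ_{d₁ | n²+1, d₂ | n²+3, max(d₁,d₂) > x^{1−η}, min(d₁,d₂) ≤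
x^{1+η}} μ(d₁) log d₁ · μ(d₂) log d₂ = o(x). Writing −Λ(fᵢ(n)) = Lᵢ + Wᵢ + Kᵢ (level d ≤ Y, window Y
< d ≤ Z, cofactor d > Z parts), this is Σ_n [L₁(W₂+K₂) + (W₁+K₁)L₂ + W₁W₂ + W₁K₂ + K₁W₂]: the k = 1
window (W) and cofactor (Q) statements of QuadraticRoots/UnimodularColumns for EACH factor, now
along the root progressions n ≡ ν_j (d_j), d_j ≤ x^{1−η}, of the OTHER factor with weights μ(d_j)
log d_j (cancellation across moduli is allowed and probably necessary), plus the balanced joint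
window W₁W₂ (d₁ ≈ d₂ ≈ x, the k = 2 sibling of UnimodularMobius). Card items Q′₁, Q′₂ and the
beyond-x part of W₁₂. [difficulty: open-problem] -/
@[route_item "route-Parity-TwoCMLines"]
def MixedTail : Prop :=
  ∀ η : ℝ, 0 < η → η < 1 / 4 → (fun x : ℕ => ∑ n ∈ Finset.Icc 1 x, ∑ d₁ ∈ Nat.divisors (n ^ 2 + 1), ∑ d₂ ∈ Nat.divisors (n ^ 2 + 3), if ((x : ℝ) ^ (1 - η) < (d₁ : ℝ) ∨ (x : ℝ) ^ (1 - η) < (d₂ : ℝ)) ∧ ((d₁ : ℝ) ≤ (x : ℝ) ^ (1 + η) ∨ (d₂ : ℝ) ≤ (x : ℝ) ^ (1 + η)) then (ArithmeticFunction.moebius d₁ : ℝ) * Real.log d₁ * ((ArithmeticFunction.moebius d₂ : ℝ) * Real.log d₂) else 0) =o[Filter.atTop] fun x : ℕ => (x : ℝ)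

/-- item stmt-Parity-0873 · support · rank 9 · open · by planner
sources: stmt-Parity-0873, BatemanHorn1962 (§2), BombieriAsymptoticSieve1976, Literature.NumberTheory.Sieve.exists_hasBatemanHornConst
[support] Type-I main term, theorem-grade: for every BH system f and η ∈ (0,1) there is C with
HasBatemanHornConst f C and (−1)^k ∑_{n≤x} ∑_{d_i | f_i(n), d_1⋯d_k ≤ x^{1−η}} ∏ μ(d_i) log d_i ~
C·x. Proof sketch: #{n ≤ x : d_i | f_i(n) ∀ i} = x ρ(d)/lcm(d) + O(ρ(d)) (period lcm(d) ≤ x^{1−η});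
the log-weighted singular series (−1)^k ∑_d ∏(μ(d_i) log d_i) ρ(d)/lcm(d) converges (ordered by the
cutoff) to the Bateman–Horn constant C(f) = ∏_p (1−1/p)^{−k}(1−ω(p)/p) by the prime ideal theorem
with error term in the splitting fields (Landau1903; BatemanHorn1962 §2; DavenportSchinzel1966; k =
1, f = X: −∑ μ(d) log d/d = 1). Named fact available:
Literature.NumberTheory.Sieve.exists_hasBatemanHornConst. Provable with substantial effort;
grounders may propose the needed Dedekind-zeta facts as Literature cites. -/
@[route_item "route-Parity-TwoCMLines"]
def TypeIMainTerm : Prop :=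
  ∀ (k : ℕ) (f : Fin k → Polynomial ℤ), Literature.NumberTheory.Sieve.IsBatemanHornSystem f → ∀ η : ℝ, 0 < η → η < 1 → ∃ C : ℝ, 0 < C ∧ Literature.NumberTheory.Sieve.HasBatemanHornConst f C ∧ Asymptotics.IsEquivalent Filter.atTop (fun x : ℕ => (-1 : ℝ) ^ k * ∑ n ∈ Finset.Icc 1 x, ∑ d ∈ Fintype.piFinset (fun i => (((f i).eval (n : ℤ)).toNat).divisors), if ∏ i, (d i : ℝ) ≤ (x : ℝ) ^ (1 - η) then ∏ i, ((ArithmeticFunction.moebius (d i) : ℝ) * Real.log (d i)) else 0) (fun x : ℕ => C * (x : ℝ))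

/-- item stmt-Parity-0874 · support · rank 9 · open · by planner
sources: stmt-Parity-0874, BatemanHorn1962
[support] From Λ-weights to the count, theorem-grade: if ∑_{n≤x} ∏_i Λ(f_i(n)) ~ C·x with
HasBatemanHornConst f C then BatemanHornAsymptotic f (polyPrimeCount f x ~ C/(∏ deg f_i) · x/(log
x)^k). Partial summation (Λ(f_i(n)) = log f_i(n) = deg f_i · log n + O(1) at prime values) plus
negligibility of proper prime-power values f_i(n) = p^a, a ≥ 2: O(x^{1/2+ε}) — trivial for deg ≤ 2,
Bombieri–Pila / Siegel integral points on y^a = f_i(x) for deg ≥ 3. C > 0 by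
Literature.NumberTheory.Sieve.exists_hasBatemanHornConst. -/
@[route_item "route-Parity-TwoCMLines"]
def LambdaToCount : Prop :=
  ∀ (k : ℕ) (f : Fin k → Polynomial ℤ), Literature.NumberTheory.Sieve.IsBatemanHornSystem f → ∀ C : ℝ, 0 < C → Literature.NumberTheory.Sieve.HasBatemanHornConst f C → Asymptotics.IsEquivalent Filter.atTop (fun x : ℕ => ∑ n ∈ Finset.Icc 1 x, ∏ i, ArithmeticFunction.vonMangoldt (((f i).eval (n : ℤ)).toNat)) (fun x : ℕ => C * (x : ℝ)) → Literature.NumberTheory.Sieve.BatemanHornAsymptotic f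

/-- item stmt-Parity-8079 · support · rank 9 · closed · moot by None · by planner
sources: BatemanHorn1962 (§1), Literature.NumberTheory.Sieve.polyRootCountMod_le, Literature.NumberTheory.Sieve.polyRootCountMod_X_sq_add_one_two
[support] F = (X²+1, X²+3) is a Bateman–Horn system: both irreducible in ℤ[X] with leading
coefficient 1, not associated, no fixed prime divisor (ω(2) = 1: only odd n; ω(3) = 1: only n ≡ 0;
ω(p) ≤ 4 < p for p ≥ 5). Provable now (Gauss-lemma irreducibility of monic quadratics without
integer roots; `decide`-style residue counts at 2, 3). [difficulty: provable-now] -/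
@[route_item "route-Parity-TwoCMLines"]
def TwoCmSystem : Prop :=
  Literature.NumberTheory.Sieve.IsBatemanHornSystem ![(Polynomial.X ^ 2 + 1 : Polynomial ℤ), Polynomial.X ^ 2 + 3]

/-- item stmt-Parity-8080 · support · rank 9 · closed · moot by None · by planner
sources: Hooley1964 (Lemma 1), Literature.NumberTheory.Sieve.polyRootWeylSum_mul_of_coprime, MartinSitar2010 (§3.2: 'Lemmas 1–3 depend only on the CRT')
[support] Crossed twisted multiplicativity (the route's dictionary lemma): for coprime c₁, c₂ with
c₁e₁ ≡ 1 (c₂), c₂e₂ ≡ 1 (c₁) and any f, g ∈ ℤ[X], Σ_{ν mod c₁c₂: c₁ | f(ν), c₂ | g(ν)} e(hν/(c₁c₂))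
= S_f(h e₂; c₁)·S_g(h e₁; c₂). Same proof as Hooley's Lemma 1 for one polynomial (tree:
polyRootWeylSum_mul_of_coprime, stdAddChar_mul_eq_mul_of_coprime), with f on one side and g on the
other; degenerate c₁c₂ = 0 holds trivially. Provable now (~40 lines). [difficulty: provable-now] -/
@[route_item "route-Parity-TwoCMLines"]
def CrossedCRT : Prop :=
  ∀ (f g : Polynomial ℤ) (c₁ c₂ : ℕ), c₁.Coprime c₂ → ∀ e₁ e₂ : ℤ, (c₁ : ℤ) * e₁ ≡ 1 [ZMOD c₂] → (c₂ : ℤ) * e₂ ≡ 1 [ZMOD c₁] → ∀ h : ℤ, (∑ ν ∈ (Finset.range (c₁ * c₂)).filter (fun ν : ℕ => (c₁ : ℤ) ∣ f.eval (ν : ℤ) ∧ (c₂ : ℤ) ∣ g.eval (ν : ℤ)), Complex.exp (2 * Real.pi * Complex.I * ((h : ℂ) * (ν : ℂ) / ((c₁ * c₂ : ℕ) : ℂ)))) = Literature.NumberTheory.Sieve.polyRootWeylSum f c₁ (h * e₂) * Literature.NumberTheory.Sieve.polyRootWeylSum g c₂ (h * e₁)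

/-- item stmt-Parity-8081 · support · rank 9 · closed · moot by None · by planner
sources: KowalskiSoundararajan2021 (arXiv:2003.12965 p.6 Thm 2.1 and p.8 Remark 2.5(1)), Hooley1964, Literature.NumberTheory.Sieve.hooley_polyRoots_logPowerSaving_holds, DartygeMartin2019 (Lemma 5), MartinSitar2010
[support] Qualitative rung under crux 5: for h ≠ 0, Σ_{c≤X} S_P(h; c) = o(X log X), P = (X²+1)(X²+3)
(the roots ν/c of P, ≍ X log X of them up to X, are equidistributed mod 1 in Hooley's measure).
Hooley's 1964 argument uses irreducibility only through the root-density input; for P the mean of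
√ρ_P(p) over primes is ¼·2 + ½·√2 = 1.207 < 2 = mean ρ_P(p), so the tree's proof of
hooley_polyRoots_logPowerSaving adapts (saving (log X)^{0.79−o(1)} on Σ|S_P|);
Kowalski–Soundararajan state the reducible case (Thm 2.1; Remark 2.5(1) for Hooley's measure).
Provable with effort. [difficulty: L] -/
@[route_item "route-Parity-TwoCMLines"]
def QuarticRootsEquidistribution : Prop :=
  ∀ h : ℤ, h ≠ 0 → (fun N : ℕ => ∑ c ∈ Finset.Icc 1 N, Literature.NumberTheory.Sieve.polyRootWeylSum ((Polynomial.X ^ 2 + 1) * (Polynomial.X ^ 2 + 3)) c h) =o[Filter.atTop] fun N : ℕ => (N : ℝ) * Real.log N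

/-- item stmt-Parity-8082 · support · rank 9 · closed · moot by None · by planner
sources: Teravainen2024 (arXiv:2010.07924 Conj. 1.2), stmt-Parity-0615, stmt-Parity-0650, planner numerics compute/run_2e6.txt (J(x) for x ≤ 2·10⁶)
[support] The unweighted joint atom (special case (e₁,e₂) = (1,1) of crux 2, numerically testable):
Σ_{n≤x} μ(n²+1)μ(n²+3) = o(x) (μ(n²+3) = 0 for odd n since 4 | n²+3, so only even n count). Open (k
= 2 polynomial Chowla, μ-form); planner numerics: 6, 63, −391, −10, 405 at x = 10³, 10⁴, 10⁵, 3·10⁵,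
10⁶, |J(y)| ≤ 1.46√y to 2·10⁶. [difficulty: open-problem] -/
@[route_item "route-Parity-TwoCMLines"]
def JointMoebiusAtom : Prop :=
  (fun x : ℕ => ∑ n ∈ Finset.Icc 1 x, (ArithmeticFunction.moebius (n ^ 2 + 1) : ℝ) * (ArithmeticFunction.moebius (n ^ 2 + 3) : ℝ)) =o[Filter.atTop] fun x : ℕ => (x : ℝ)

/-- item stmt-Parity-8083 · assembly · rank 1 · closed · moot by None · by planner
sources: BatemanHorn1962, Mathlib ArithmeticFunction.sum_moebius_mul_log_eq, stmt-Parity-0875 (PolynomialMobius.Assembly: same bookkeeping for all k)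
[assembly] CrossedMoebius → MixedTail → JointCofactor → TypeIMainTerm → LambdaToCount → TwoCmSystem
→ TwoCmBH (the k = 2, F-slice of BatemanHorn; provable now, pure bookkeeping as above). -/
@[route_item "route-Parity-TwoCMLines"]
def Assembly : Prop :=
  CrossedMoebius → MixedTail → JointCofactor → TypeIMainTerm → LambdaToCount → TwoCmSystem → TwoCmBH

end Summit.Parity.BatemanHorn.Theses.TwoCMLines
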